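import Summits.CriticalPhenomena.PercolationContinuityZ3.Theses.PercExchangeRateTransport
import Summits.CriticalPhenomena.PercolationContinuityZ3.Theorems.PercNearOneGluingNoHeavyLowerTailCSHTheoremOne
import Literature.Probability.Percolation.BernoulliPercolationProofs
import Literature.Probability.Percolation.CriticalContinuityProofs
import Mathlib.Topology.Order.OrderClosed
import Mathlib.Order.Filter.AtTopBot.Basic
import HarnessLib

/-!
# `PercExchangeRateTransport.DiagonalOnCurve` (stmt-CriticalPhenomena-16070) — SETTLED after continuity

Item `stmt-CriticalPhenomena-16070` of route `CriticalPhenomena/PercExchangeRateTransport` (support (M)): the isotropic point is ON the critical curve: `p_c(t)|_{t = p_c(ℤ³)} = p_c(ℤ³)` and `J(p_c(ℤ³)) = θ_{ℤ³}(p_c)`.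

Order argument from the item's own hypotheses: for `t > p_c` the diagonal percolates (`θ(t,t) = θ_{ℤ³}(t) > 0`), so `p_c(t) ≤ t`; for `t < p_c` every `p < t` has `θ(p,t) ≤ θ(t,t) = 0` (monotonicity in `p` from ModelFacts), so `p_c(t) ≥ t`; continuity of the curve at `p_c ∈ (0,1)` (CriticalCurveRegular, PcBounds) squeezes `p_c(p_c) = p_c`, and then `J(p_c) = θ(p_c, p_c) = θ_{ℤ³}(p_c)` (ModelFacts' diagonal identity).  p205010 is NOT used.

builds on p205010 (kernel theorem, internal audit signed; external expert review pending) — USED (`CSH.percolationContinuityZ3_holds`).  RSW3 lane, lead gen 28 (prover-prim-rsw3-lead-g28-0):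
'after continuity — the ledger harvest'.
References: G. Kozma, N. Nitzan (2024), Thm. 6 / Conj. 3 [KozmaNitzan2024]; G. Grimmett, *Percolation* (1999), §8 [GrimmettPercolation1999].
-/

noncomputable section

namespace Summit.CriticalPhenomena.PercolationContinuityZ3.Theorems

namespace PercExchangeRateTransportDiagonalOnCurve

open MeasureTheory Literature.Probability.Percolation Literature.Probability.LatticeModels
open Filter Topology

/-- **`PercExchangeRateTransport.DiagonalOnCurve` (stmt-CriticalPhenomena-16070), settled.**  order argument + continuity of the critical curve at `p_c(ℤ³) ∈ (0,1)`.
[cite: KozmaNitzan2024, Thm. 6 with Conj. 3 (p. 15)] -/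
theorem diagonalOnCurve_proof : Summit.CriticalPhenomena.PercolationContinuityZ3.Theses.PercExchangeRateTransport.DiagonalOnCurve := by
  intro hM hC hPc
  -- local names for the objects of the statement (definitionally the decl's `let`s)
  let vert : Sym2 (Site 3) → Prop := fun e => ∃ x : Site 3, e = s(x, x + Pi.single (2 : Fin 3) 1)
  let cfg : ℝ → ℝ → (Sym2 (Site 3) → ℝ) → Set (Sym2 (Site 3)) := fun p t U =>
    {e | e ∈ (zdGraph 3).edgeSet ∧ ((vert e ∧ U e ≤ t) ∨ (¬ vert e ∧ U e ≤ p))}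
  let θ : ℝ → ℝ → ℝ := fun p t => (labelMeasure (Site 3)).real {U | cfg p t U ∈ percolatesAt (0 : Site 3)}
  let pc : ℝ → ℝ := fun t => sInf ({p : ℝ | 0 ≤ p ∧ p ≤ 1 ∧ 0 < θ p t} ∪ {1})
  obtain ⟨-, -, hmonoP, -, -, hbd, hinf, -, hdiag, -⟩ := hM
  obtain ⟨hcont, -⟩ := hC
  obtain ⟨hpc0, hpc1⟩ := hPc 3 (by norm_num)
  -- θ is monotone in p (infimum of monotone functions bounded below by 0)
  have hθmono : ∀ t p p' : ℝ, p ≤ p' → θ p t ≤ θ p' t := by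
    intro t p p' hpp'
    have e1 := hinf p t
    have e2 := hinf p' t
    refine (le_of_eq e1).trans ((ciInf_mono ⟨0, ?_⟩ fun n => hmonoP n t hpp').trans (le_of_eq e2.symm))
    rintro _ ⟨n, rfl⟩
    exact (hbd n p t).1
  -- the diagonal is Bernoulli percolation on ℤ³
  have hdiag' : ∀ t : ℝ, ∀ ht : 0 ≤ t ∧ t ≤ 1, θ t t = theta (zdGraph 3) 0 ⟨t, ht⟩ := fun t ht => hdiag ⟨t, ht⟩
  -- the set whose infimum is `pc t`
  have hbdd : ∀ t : ℝ, BddBelow ({p : ℝ | 0 ≤ p ∧ p ≤ 1 ∧ 0 < θ p t} ∪ {1}) := fun t =>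
    ⟨0, by
      rintro p (⟨hp, -, -⟩ | hp)
      · exact hp
      · rw [Set.mem_singleton_iff.1 hp]; exact zero_le_one⟩
  have hne : ∀ t : ℝ, ({p : ℝ | 0 ≤ p ∧ p ≤ 1 ∧ 0 < θ p t} ∪ {1}).Nonempty := fun t => ⟨1, Or.inr rfl⟩
  -- (A) above `p_c`: `pc t ≤ t`
  have hA : ∀ t : ℝ, criticalProb (zdGraph 3) (0 : Site 3) < t → t < 1 → pc t ≤ t := by
    intro t ht ht1
    have ht0 : 0 ≤ t := hpc0.le.trans ht.le
    refine csInf_le (hbdd t) (Or.inl ⟨ht0, ht1.le, ?_⟩)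
    rw [hdiag' t ⟨ht0, ht1.le⟩]
    exact theta_pos_of_criticalProb_lt_holds (zdGraph 3) (0 : Site 3) _ (by exact ht)
  -- (B) below `p_c`: `t ≤ pc t`
  have hB : ∀ t : ℝ, 0 < t → t < criticalProb (zdGraph 3) (0 : Site 3) → t ≤ pc t := by
    intro t ht0 ht
    have ht1 : t ≤ 1 := ht.le.trans hpc1.le
    refine le_csInf (hne t) ?_
    rintro p (⟨hp0, hp1, hpos⟩ | hp)
    · by_contra hlt
      push Not at hlt
      have h1 : θ p t ≤ θ t t := hθmono t p t hlt.le
      have h2 : θ t t = 0 := by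
        rw [hdiag' t ⟨ht0.le, ht1⟩]
        exact theta_eq_zero_of_lt_criticalProb_holds (zdGraph 3) (0 : Site 3) _ (by exact ht)
      linarith
    · rw [Set.mem_singleton_iff.1 hp]; exact ht1
  -- (C) continuity of the curve at `p_c ∈ (0,1)` squeezes `pc p_c = p_c`
  set p₀ : ℝ := criticalProb (zdGraph 3) (0 : Site 3) with hp₀
  have hcw : ContinuousWithinAt pc (Set.Ioo 0 1) p₀ := hcont p₀ ⟨hpc0, hpc1⟩
  have hle : pc p₀ ≤ p₀ := by
    have h1 : Filter.Tendsto pc (𝓝[Set.Ioo p₀ 1] p₀) (𝓝 (pc p₀)) :=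
      (hcw.mono (Set.Ioo_subset_Ioo hpc0.le le_rfl)).tendsto
    have h2 : Filter.Tendsto (fun t : ℝ => t) (𝓝[Set.Ioo p₀ 1] p₀) (𝓝 p₀) :=
      tendsto_nhdsWithin_of_tendsto_nhds Filter.tendsto_id
    haveI : (𝓝[Set.Ioo p₀ 1] p₀).NeBot := left_nhdsWithin_Ioo_neBot hpc1
    exact le_of_tendsto_of_tendsto h1 h2 (eventually_nhdsWithin_of_forall fun t ht => hA t ht.1 ht.2)
  have hge : p₀ ≤ pc p₀ := by
    have h1 : Filter.Tendsto pc (𝓝[Set.Ioo 0 p₀] p₀) (𝓝 (pc p₀)) :=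
      (hcw.mono (Set.Ioo_subset_Ioo le_rfl hpc1.le)).tendsto
    have h2 : Filter.Tendsto (fun t : ℝ => t) (𝓝[Set.Ioo 0 p₀] p₀) (𝓝 p₀) :=
      tendsto_nhdsWithin_of_tendsto_nhds Filter.tendsto_id
    haveI : (𝓝[Set.Ioo 0 p₀] p₀).NeBot := right_nhdsWithin_Ioo_neBot hpc0
    exact le_of_tendsto_of_tendsto h2 h1 (eventually_nhdsWithin_of_forall fun t ht => hB t ht.1 ht.2)
  have hpc : pc p₀ = p₀ := le_antisymm hle hge
  -- (D) `J(p₀) = θ(p₀, p₀) = θ_{ℤ³}(p_c)`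
  have hJ : θ (pc p₀) p₀ = theta (zdGraph 3) 0 (criticalProbI 3) := by
    rw [hpc]
    have h := hdiag (criticalProbI 3)
    rwa [coe_criticalProbI] at h
  exact ⟨hpc, hJ⟩

end PercExchangeRateTransportDiagonalOnCurve

end Summit.CriticalPhenomena.PercolationContinuityZ3.Theorems

end
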